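/-
Copyright (c) 2026 the pub-hodgecm-mathlib formalisation cell (harness21).  Prover seat hodgecm-mathlib-LH4-p01 (g12): road M6 → F5 → dyadic chain of `stub_DyUnramCore` (D-UNR),
site (L2-3) «THE WALL», row 8 «S-ROWS-aff» of CENSUS-L23-CM v1 (LH10-p01 (g12)); 2026-09-03.
-/
import Literature.NumberTheory.Rogawski1990.DepthZeroTransferHValuesShift              -- ★ p846474 (END F0P3a-p03): §1∕§2 `apply_sub_two_eq_of_succ_sub_mul_eq`, `phiHtwo_sub_two_eq`; §3 the tame rows (pattern)
import Literature.NumberTheory.Rogawski1990.DepthZeroTransferHValuesTypeTwoChiAffine     -- ★ p853455 (LH4-p01 (g11)): the `|2|`-free heads `…chiZero∕chiOne…_of_not_exists_isRoot_affine` (admissible Eisenstein centre)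
import HarnessLib

/-!
# T3′'s H-side values under the depth shift `j ↦ j − 1`, TYPE (2), in the EISENSTEIN-CENTRE currency (any residue characteristic): the matrix `S = !![1, −q⁻¹; 0, q⁻¹]`

Topic `NumberTheory/Rogawski1990`; namespace `Literature.NumberTheory.Automorphic.UnitaryGroup` (as ★ `DepthZeroTransferHValuesShift` §3).  THEOREMS ONLY (no definition, no
instance, no notation, no named fact, no `sorry`); kernel lane `--supports stmt-HodgeConjecture-24833`.  Cell `pub/hodgecm-mathlib` (D-0151), crux H413 =
`stmt-HodgeConjecture-24833`; road M6 → F5 → the dyadic chain of organ (D-UNR) `stub_DyUnramCore`, LEVEL TWO, site (L2-3) «THE WALL» = ★ `liftInterior_of_levelTwo` with `h2`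
deleted; this file is ROW 8 of LH10-p01 (g12)'s CENSUS-L23-CM v1 (call site ★ `LevelTwoLiftInterior` :396): the type-(2) S-rows.  (The type-(1) rows ★
`stableOrbitalIntegralRel_chi_shift_of_isRoot` are already 2-free, in the root currency.)

THE MATHEMATICS.  ★ `stableOrbitalIntegralRel_chi_shift_of_not_exists_isRoot` reads the depths of `γ_H`, `u_H` in the DISCRIMINANT currency `|tr² − 4det|_w = exp(−(2N+1))`
and calls the ★ Chi heads under `(h2 : IsUnit 2)`.  At `v ∣ 2` that currency is not available; the `|2|`-free heads ★ `…chiZero_eq_mul_phiHtwo_of_not_exists_isRoot_affine` ∕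
`…chiOne_eq_mul_phiHtwo_sub_of_not_exists_isRoot_affine` (LH4-p01 (g11), p853455) read the depth `j` off an ADMISSIBLE EISENSTEIN CENTRE `(a, f, e′, j)` of `(γ₂)_w`
(`a ∈ 𝒪_w`, `tr − 2a = f`, `|f| ≤ |ϖ|^{j+1}`, `a² − tr·a + det = −e′`, `|e′| = |ϖ|^{2j+1}`; at `v ∤ 2` one may take `a = tr∕2`, `f = 0`, `j = N`).  Given such centres for `γ_H`
(depth `j ≥ 2`) and `u_H` (depth `j − 1`) the four stable values are `ν_H(K_H)·phiHtwo q (j−1)`, `ν_H(K_H)·(phiHtwo q j − phiHtwo q (j−1))` and the same at `j − 1`, and the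
sequence identity ★ `phiHtwo_sub_two_eq` (`F(M+1) − q·F(M)` constant) gives
  `Φ^st(u_H, χ₀) = Φ^st(γ_H, χ₀) − q⁻¹·Φ^st(γ_H, χ₁)`, `Φ^st(u_H, χ₁) = q⁻¹·Φ^st(γ_H, χ₁)`
— the matrix `S = !![1, −q⁻¹; 0, q⁻¹]`, identical to the type-(1) row.  How the centre of `u_H = φ_θ(γ_H)` is obtained from that of `γ_H` under the hermitian Cayley shift is the
business of the binders (row 5 of the census), not of this file.
HONEST LABEL: HC_CM is proved only modulo the 7 printed citations (2 remaining: hLiu418 = stmt-HodgeConjecture-24832, h413 = stmt-HodgeConjecture-24833) until rung 0 closes;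
count-neutral (zero label movement; L2-3 stays THE WALL until every row of CENSUS-L23-CM is paid).

## References
* [Rogawski1990] J. D. Rogawski, *Automorphic Representations of Unitary Groups in Three Variables*, Ann. of Math. Stud. 123 (1990): §4.9 Prop. 4.9.1 (b) p. 55; §3.6 p. 31.
* [Kottwitz1986BaseChangeUnits] R. E. Kottwitz, *Base change for unit elements of Hecke algebras*, Compositio Math. 60 (1986): §1 pp. 240–241, §3.
* [Flicker1998UnitaryFL] Y. Z. Flicker, *Elementary proof of the fundamental lemma for a unitary group*, Canad. J. Math. 50 (1998): §6 p. 97.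
-/

set_option autoImplicit false

noncomputable section

open MeasureTheory Measure Set Filter Topology NumberField IsDedekindDomain Matrix Polynomial ValuativeRel
open scoped ENNReal NNReal ValuativeRel Matrix MatrixGroups

namespace Literature.NumberTheory.Automorphic.UnitaryGroup

open Literature.NumberTheory.Rogawski1990 Literature.NumberTheory.Automorphic Literature.NumberTheory.Automorphic.IntegralReduction

/-! ## The type-(2) S-rows at two Eisenstein centres -/

section Place

variable (L : Type) [Field L] [NumberField L] [IsCMField L] (v : HeightOneSpectrum (𝓞 ↥(maximalRealSubfield L)))
  (w : PlacesOver L v) (hw : IsCMField.complexConj L • w.1 = w.1)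
  [MeasurableSpace ((cmDatum L 2 (Matrix.of fun i j : Fin 2 => if i.val + j.val + 1 = 2 then (1 : L) else 0)).Local v × (cmDatum L 1 (Matrix.of fun i j : Fin 1 => if i.val + j.val + 1 = 1 then (1 : L) else 0)).Local v)] [BorelSpace ((cmDatum L 2 (Matrix.of fun i j : Fin 2 => if i.val + j.val + 1 = 2 then (1 : L) else 0)).Local v × (cmDatum L 1 (Matrix.of fun i j : Fin 1 => if i.val + j.val + 1 = 1 then (1 : L) else 0)).Local v)]
  [∀ a : (cmDatum L 2 (Matrix.of fun i j : Fin 2 => if i.val + j.val + 1 = 2 then (1 : L) else 0)).Local v × (cmDatum L 1 (Matrix.of fun i j : Fin 1 => if i.val + j.val + 1 = 1 then (1 : L) else 0)).Local v, MeasurableSpace (((cmDatum L 2 (Matrix.of fun i j : Fin 2 => if i.val + j.val + 1 = 2 then (1 : L) else 0)).Local v × (cmDatum L 1 (Matrix.of fun i j : Fin 1 => if i.val + j.val + 1 = 1 then (1 : L) else 0)).Local v) ⧸ Subgroup.centralizer ({a} : Set ((cmDatum L 2 (Matrix.of fun i j : Fin 2 => if i.val + j.val + 1 = 2 then (1 :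 L) else 0)).Local v × (cmDatum L 1 (Matrix.of fun i j : Fin 1 => if i.val + j.val + 1 = 1 then (1 : L) else 0)).Local v)))]
  [∀ a : (cmDatum L 2 (Matrix.of fun i j : Fin 2 => if i.val + j.val + 1 = 2 then (1 : L) else 0)).Local v × (cmDatum L 1 (Matrix.of fun i j : Fin 1 => if i.val + j.val + 1 = 1 then (1 : L) else 0)).Local v, BorelSpace (((cmDatum L 2 (Matrix.of fun i j : Fin 2 => if i.val + j.val + 1 = 2 then (1 : L) else 0)).Local v × (cmDatum L 1 (Matrix.of fun i j : Fin 1 => if i.val + j.val + 1 = 1 then (1 : L) else 0)).Local v) ⧸ Subgroup.centralizer ({a} : Set ((cmDatum L 2 (Matrix.of fun i j : Fin 2 => if i.val + j.val + 1 = 2 then (1 : L) else 0)).Local v × (cmDatum L 1 (Matrix.of fun i j : Fin 1 => if i.val + j.val + 1 = 1 then (1 : L) else 0)).Local v)))]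
  (νH : Measure ((cmDatum L 2 (Matrix.of fun i j : Fin 2 => if i.val + j.val + 1 = 2 then (1 : L) else 0)).Local v × (cmDatum L 1 (Matrix.of fun i j : Fin 1 => if i.val + j.val + 1 = 1 then (1 : L) else 0)).Local v)) [νH.IsHaarMeasure] [νH.IsMulRightInvariant]

set_option maxHeartbeats 400000 in
include hw in
/-- **H-SIDE SHIFT, TYPE (2), EISENSTEIN CENTRES (any residue characteristic): `Φ^st(u_H, χ₀) = Φ^st(γ_H, χ₀) − q⁻¹·Φ^st(γ_H, χ₁)` and
`Φ^st(u_H, χ₁) = q⁻¹·Φ^st(γ_H, χ₁)`** for `G`-regular `γ_H, u_H` of type (2) (irreducible `w`-characteristic polynomial of the `U(2)`-component), deep by trace and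
determinant, carrying ADMISSIBLE EISENSTEIN CENTRES `(a, f, e′, j)` and `(a′, f′, e″, j − 1)` with `2 ≤ j` (frame of ★ `…chiZero∕chiOne…_of_not_exists_isRoot_affine`:
`a ∈ 𝒪_w`, `tr − 2a = f`, `|f| ≤ |ϖ|^{j+1}`, `a² − tr·a + det = −e′`, `|e′| = |ϖ|^{2j+1}`) — the `|2|`-free twin of ★ `stableOrbitalIntegralRel_chi_shift_of_not_exists_isRoot`
(its `IsUnit 2 ∕ hint ∕ N hN ∕ hint′ hN′` binders ↦ the two centres; at `v ∤ 2`: `a = tr∕2`, `f = 0`, `j = N`): both sides are `ν_H(K_H)` times the closed forms `phiHtwo q (j−1)`,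
`phiHtwo q j − phiHtwo q (j−1)` resp. at `j − 1`, and ★ §2 `phiHtwo_sub_two_eq` gives the SAME matrix `S = !![1, −q⁻¹; 0, q⁻¹]` as for type (1) (A-91b).
Row 8 of CENSUS-L23-CM v1 (the H-side S-rows of the 2-free organ (I)).  Decidability binders `χdec₀ χdec₁` (pass `_`).
[cite: Rogawski1990, §4.9 Prop. 4.9.1 (b) p. 55] [cite: Kottwitz1986BaseChangeUnits, §1 pp. 240–241; §3] [cite: Flicker1998UnitaryFL, §6 p. 97] -/
theorem stableOrbitalIntegralRel_chi_shift_of_not_exists_isRoot_affine (hunr : Algebra.IsUnramifiedIn (𝓞 L) v.asIdeal)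
    {mH : OrbitalMeasureFamily ((cmDatum L 2 (Matrix.of fun i j : Fin 2 => if i.val + j.val + 1 = 2 then (1 : L) else 0)).Local v × (cmDatum L 1 (Matrix.of fun i j : Fin 1 => if i.val + j.val + 1 = 1 then (1 : L) else 0)).Local v)} (hmH : mH.IsCanonical (IsLocalGRegular L v) νH)
    {γH : (cmDatum L 2 (Matrix.of fun i j : Fin 2 => if i.val + j.val + 1 = 2 then (1 : L) else 0)).Local v × (cmDatum L 1 (Matrix.of fun i j : Fin 1 => if i.val + j.val + 1 = 1 then (1 : L) else 0)).Local v} (hreg : IsLocalGRegular L v γH)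
    [CompactSpace (Subgroup.centralizer ({γH.1} : Set ((cmDatum L 2 (Matrix.of fun i j : Fin 2 => if i.val + j.val + 1 = 2 then (1 : L) else 0)).Local v)))]
    (hirr : ¬ ∃ x : (w.1.adicCompletion L), (((((γH).1.val : GL (Fin 2) (UnitaryGroup.LocalRing L v)).val.map (Pi.evalRingHom (fun w' : PlacesOver L v => w'.1.adicCompletion L) w))).charpoly).IsRoot x)
    {a f e' : (w.1.adicCompletion L)} (haO : a ∈ 𝒪[(w.1.adicCompletion L)]) {j : ℕ}
    (hf : valuation (w.1.adicCompletion L) f ≤ valuation (w.1.adicCompletion L) ((toPlace v w (GaloisRepresentations.HeckeCharacter.uniformizer ↥(maximalRealSubfield L) v : v.adicCompletion ↥(maximalRealSubfield L))) ^ (j + 1)))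
    (hj : valuation (w.1.adicCompletion L) e' = valuation (w.1.adicCompletion L) ((toPlace v w (GaloisRepresentations.HeckeCharacter.uniformizer ↥(maximalRealSubfield L) v : v.adicCompletion ↥(maximalRealSubfield L))) ^ (2 * j + 1)))
    (htf : ((((γH).1.val : GL (Fin 2) (UnitaryGroup.LocalRing L v)).val.map (Pi.evalRingHom (fun w' : PlacesOver L v => w'.1.adicCompletion L) w))).trace - 2 * a = f) (hde : a * a - ((((γH).1.val : GL (Fin 2) (UnitaryGroup.LocalRing L v)).val.map (Pi.evalRingHom (fun w' : PlacesOver L v => w'.1.adicCompletion L) w))).trace * a + ((((γH).1.val : GL (Fin 2) (UnitaryGroup.LocalRing L v)).val.map (Pi.evalRingHom (fun w' : PlacesOver L v => w'.1.adicCompletion L) w))).det = -e')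
    (htr : Valued.v (((((γH).1.val : GL (Fin 2) (UnitaryGroup.LocalRing L v)).val.map (Pi.evalRingHom (fun w' : PlacesOver L v => w'.1.adicCompletion L) w))).trace - 2) < 1) (hdet : Valued.v (((((γH).1.val : GL (Fin 2) (UnitaryGroup.LocalRing L v)).val.map (Pi.evalRingHom (fun w' : PlacesOver L v => w'.1.adicCompletion L) w))).det - 1) < 1)
    {uH : (cmDatum L 2 (Matrix.of fun i j : Fin 2 => if i.val + j.val + 1 = 2 then (1 : L) else 0)).Local v × (cmDatum L 1 (Matrix.of fun i j : Fin 1 => if i.val + j.val + 1 = 1 then (1 : L) else 0)).Local v} (hreg' : IsLocalGRegular L v uH)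
    [CompactSpace (Subgroup.centralizer ({uH.1} : Set ((cmDatum L 2 (Matrix.of fun i j : Fin 2 => if i.val + j.val + 1 = 2 then (1 : L) else 0)).Local v)))]
    (hirr' : ¬ ∃ x : (w.1.adicCompletion L), (((((uH).1.val : GL (Fin 2) (UnitaryGroup.LocalRing L v)).val.map (Pi.evalRingHom (fun w' : PlacesOver L v => w'.1.adicCompletion L) w))).charpoly).IsRoot x)
    {a' f' e'' : (w.1.adicCompletion L)} (haO' : a' ∈ 𝒪[(w.1.adicCompletion L)])
    (hf' : valuation (w.1.adicCompletion L) f' ≤ valuation (w.1.adicCompletion L) ((toPlace v w (GaloisRepresentations.HeckeCharacter.uniformizer ↥(maximalRealSubfield L) v : v.adicCompletion ↥(maximalRealSubfield L))) ^ (j - 1 + 1)))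
    (hj' : valuation (w.1.adicCompletion L) e'' = valuation (w.1.adicCompletion L) ((toPlace v w (GaloisRepresentations.HeckeCharacter.uniformizer ↥(maximalRealSubfield L) v : v.adicCompletion ↥(maximalRealSubfield L))) ^ (2 * (j - 1) + 1)))
    (htf' : ((((uH).1.val : GL (Fin 2) (UnitaryGroup.LocalRing L v)).val.map (Pi.evalRingHom (fun w' : PlacesOver L v => w'.1.adicCompletion L) w))).trace - 2 * a' = f') (hde' : a' * a' - ((((uH).1.val : GL (Fin 2) (UnitaryGroup.LocalRing L v)).val.map (Pi.evalRingHom (fun w' : PlacesOver L v => w'.1.adicCompletion L) w))).trace * a' + ((((uH).1.val : GL (Fin 2) (UnitaryGroup.LocalRing L v)).val.map (Pi.evalRingHom (fun w' : PlacesOver L v => w'.1.adicCompletion L) w))).det = -e'')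
    (htr' : Valued.v (((((uH).1.val : GL (Fin 2) (UnitaryGroup.LocalRing L v)).val.map (Pi.evalRingHom (fun w' : PlacesOver L v => w'.1.adicCompletion L) w))).trace - 2) < 1) (hdet' : Valued.v (((((uH).1.val : GL (Fin 2) (UnitaryGroup.LocalRing L v)).val.map (Pi.evalRingHom (fun w' : PlacesOver L v => w'.1.adicCompletion L) w))).det - 1) < 1) (h2j : 2 ≤ j)
    (χdec₀ : ∀ h : ((cmDatum L 2 (Matrix.of fun i j : Fin 2 => if i.val + j.val + 1 = 2 then (1 : L) else 0)).Local v × (cmDatum L 1 (Matrix.of fun i j : Fin 1 => if i.val + j.val + 1 = 1 then (1 : L) else 0)).Local v), Decidable ((redMat (((h).1.val : GL (Fin 2) (UnitaryGroup.LocalRing L v)).val.map (Pi.evalRingHom (fun w' : PlacesOver L v => w'.1.adicCompletion L) w)) - 1) ^ 2 = 0 ∧ (redMat (((h).1.val : GL (Fin 2) (UnitaryGroup.LocalRing L v)).val.map (Pi.evalRingHom (fun w' : PlacesOver L v => w'.1.adicCompletion L) w)) - 1).rank = 0)) (χdec₁ : ∀ h : ((cmDatum L 2 (Matrix.of fun i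 j : Fin 2 => if i.val + j.val + 1 = 2 then (1 : L) else 0)).Local v × (cmDatum L 1 (Matrix.of fun i j : Fin 1 => if i.val + j.val + 1 = 1 then (1 : L) else 0)).Local v), Decidable ((redMat (((h).1.val : GL (Fin 2) (UnitaryGroup.LocalRing L v)).val.map (Pi.evalRingHom (fun w' : PlacesOver L v => w'.1.adicCompletion L) w)) - 1) ^ 2 = 0 ∧ (redMat (((h).1.val : GL (Fin 2) (UnitaryGroup.LocalRing L v)).val.map (Pi.evalRingHom (fun w' : PlacesOver L v => w'.1.adicCompletion L) w)) - 1).rank = 1)) :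
    stableOrbitalIntegralRel (IsLocalStablyConjH L v) mH (((((cmLocalIntegralLevel L 2 (Matrix.of fun i j : Fin 2 => if i.val + j.val + 1 = 2 then (1 : L) else 0) v).prod (cmLocalIntegralLevel L 1 (Matrix.of fun i j : Fin 1 => if i.val + j.val + 1 = 1 then (1 : L) else 0) v)) : Subgroup ((cmDatum L 2 (Matrix.of fun i j : Fin 2 => if i.val + j.val + 1 = 2 then (1 : L) else 0)).Local v × (cmDatum L 1 (Matrix.of fun i j : Fin 1 => if i.val + j.val + 1 = 1 then (1 : L) else 0)).Local v)) : Set ((cmDatum L 2 (Matrix.of fun i j : Fin 2 => if i.val + j.val + 1 = 2 then (1 : L) else 0)).Local v × (cmDatum L 1 (Matrix.of fun i j : Fin 1 => if i.val + j.val + 1 = 1 then (1 : L) else 0)).Local v)).indicator fun h => if (redMat (((h).1.val : GL (Fin 2) (UnitaryGroup.LocalRing L v)).val.map (Pi.evalRingHom (fun w' : PlacesOver L v => w'.1.adicCompletion L) w)) - 1) ^ 2 = 0 ∧ (redMat (((h).1.val : GL (Fin 2) (UnitaryGroup.LocalRing L v)).val.map (Pi.evalRingHom (fun w' : PlacesOver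 L v => w'.1.adicCompletion L) w)) - 1).rank = 0 then (1 : ℂ) else 0) uH =
        stableOrbitalIntegralRel (IsLocalStablyConjH L v) mH (((((cmLocalIntegralLevel L 2 (Matrix.of fun i j : Fin 2 => if i.val + j.val + 1 = 2 then (1 : L) else 0) v).prod (cmLocalIntegralLevel L 1 (Matrix.of fun i j : Fin 1 => if i.val + j.val + 1 = 1 then (1 : L) else 0) v)) : Subgroup ((cmDatum L 2 (Matrix.of fun i j : Fin 2 => if i.val + j.val + 1 = 2 then (1 : L) else 0)).Local v × (cmDatum L 1 (Matrix.of fun i j : Fin 1 => if i.val + j.val + 1 = 1 then (1 : L) else 0)).Local v)) : Set ((cmDatum L 2 (Matrix.of fun i j : Fin 2 => if i.val + j.val + 1 = 2 then (1 : L) else 0)).Local v × (cmDatum L 1 (Matrix.of fun i j : Fin 1 => if i.val + j.val + 1 = 1 then (1 : L) else 0)).Local v)).indicator fun h => if (redMat (((h).1.val : GL (Fin 2) (UnitaryGroup.LocalRing L v)).val.map (Pi.evalRingHom (fun w' : PlacesOver L v => w'.1.adicCompletion L) w)) - 1) ^ 2 = 0 ∧ (redMat (((h).1.val : GL (Fin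 2) (UnitaryGroup.LocalRing L v)).val.map (Pi.evalRingHom (fun w' : PlacesOver L v => w'.1.adicCompletion L) w)) - 1).rank = 0 then (1 : ℂ) else 0) γH -
          ((Ideal.absNorm v.asIdeal : ℕ) : ℂ)⁻¹ * stableOrbitalIntegralRel (IsLocalStablyConjH L v) mH (((((cmLocalIntegralLevel L 2 (Matrix.of fun i j : Fin 2 => if i.val + j.val + 1 = 2 then (1 : L) else 0) v).prod (cmLocalIntegralLevel L 1 (Matrix.of fun i j : Fin 1 => if i.val + j.val + 1 = 1 then (1 : L) else 0) v)) : Subgroup ((cmDatum L 2 (Matrix.of fun i j : Fin 2 => if i.val + j.val + 1 = 2 then (1 : L) else 0)).Local v × (cmDatum L 1 (Matrix.of fun i j : Fin 1 => if i.val + j.val + 1 = 1 then (1 : L) else 0)).Local v)) : Set ((cmDatum L 2 (Matrix.of fun i j : Fin 2 => if i.val + j.val + 1 = 2 then (1 : L) else 0)).Local v × (cmDatum L 1 (Matrix.of fun i j : Fin 1 => if i.val + j.val + 1 = 1 then (1 : L) else 0)).Local v)).indicator fun h => if (redMat (((h).1.val : GL (Fin 2) (UnitaryGroup.LocalRing L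 v)).val.map (Pi.evalRingHom (fun w' : PlacesOver L v => w'.1.adicCompletion L) w)) - 1) ^ 2 = 0 ∧ (redMat (((h).1.val : GL (Fin 2) (UnitaryGroup.LocalRing L v)).val.map (Pi.evalRingHom (fun w' : PlacesOver L v => w'.1.adicCompletion L) w)) - 1).rank = 1 then (1 : ℂ) else 0) γH ∧
      stableOrbitalIntegralRel (IsLocalStablyConjH L v) mH (((((cmLocalIntegralLevel L 2 (Matrix.of fun i j : Fin 2 => if i.val + j.val + 1 = 2 then (1 : L) else 0) v).prod (cmLocalIntegralLevel L 1 (Matrix.of fun i j : Fin 1 => if i.val + j.val + 1 = 1 then (1 : L) else 0) v)) : Subgroup ((cmDatum L 2 (Matrix.of fun i j : Fin 2 => if i.val + j.val + 1 = 2 then (1 : L) else 0)).Local v × (cmDatum L 1 (Matrix.of fun i j : Fin 1 => if i.val + j.val + 1 = 1 then (1 : L) else 0)).Local v)) : Set ((cmDatum L 2 (Matrix.of fun i j : Fin 2 => if i.val + j.val + 1 = 2 then (1 : L) else 0)).Local v × (cmDatum L 1 (Matrix.of fun i j : Fin 1 => if i.val + j.val + 1 = 1 then (1 : L) else 0)).Local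 v)).indicator fun h => if (redMat (((h).1.val : GL (Fin 2) (UnitaryGroup.LocalRing L v)).val.map (Pi.evalRingHom (fun w' : PlacesOver L v => w'.1.adicCompletion L) w)) - 1) ^ 2 = 0 ∧ (redMat (((h).1.val : GL (Fin 2) (UnitaryGroup.LocalRing L v)).val.map (Pi.evalRingHom (fun w' : PlacesOver L v => w'.1.adicCompletion L) w)) - 1).rank = 1 then (1 : ℂ) else 0) uH =
        ((Ideal.absNorm v.asIdeal : ℕ) : ℂ)⁻¹ * stableOrbitalIntegralRel (IsLocalStablyConjH L v) mH (((((cmLocalIntegralLevel L 2 (Matrix.of fun i j : Fin 2 => if i.val + j.val + 1 = 2 then (1 : L) else 0) v).prod (cmLocalIntegralLevel L 1 (Matrix.of fun i j : Fin 1 => if i.val + j.val + 1 = 1 then (1 : L) else 0) v)) : Subgroup ((cmDatum L 2 (Matrix.of fun i j : Fin 2 => if i.val + j.val + 1 = 2 then (1 : L) else 0)).Local v × (cmDatum L 1 (Matrix.of fun i j : Fin 1 => if i.val + j.val + 1 = 1 then (1 : L) else 0)).Local v)) : Set ((cmDatum L 2 (Matrix.of fun i j : Fin 2 => if i.val + j.val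 + 1 = 2 then (1 : L) else 0)).Local v × (cmDatum L 1 (Matrix.of fun i j : Fin 1 => if i.val + j.val + 1 = 1 then (1 : L) else 0)).Local v)).indicator fun h => if (redMat (((h).1.val : GL (Fin 2) (UnitaryGroup.LocalRing L v)).val.map (Pi.evalRingHom (fun w' : PlacesOver L v => w'.1.adicCompletion L) w)) - 1) ^ 2 = 0 ∧ (redMat (((h).1.val : GL (Fin 2) (UnitaryGroup.LocalRing L v)).val.map (Pi.evalRingHom (fun w' : PlacesOver L v => w'.1.adicCompletion L) w)) - 1).rank = 1 then (1 : ℂ) else 0) γH := by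
  have hq : 1 < Ideal.absNorm v.asIdeal := NumberField.HeightOneSpectrum.one_lt_absNorm v
  obtain ⟨e1, e2⟩ := phiHtwo_sub_two_eq hq h2j
  rw [show j - 2 = j - 1 - 1 by omega] at e1 e2
  have hj1 : 1 ≤ j := by omega
  have hj1' : 1 ≤ j - 1 := by omega
  -- the two scalar identities, cast to `ℂ`
  have E1 : ((Flicker1998.phiHtwo (Ideal.absNorm v.asIdeal) (j - 1 - 1) : ℚ) : ℂ) = ((Flicker1998.phiHtwo (Ideal.absNorm v.asIdeal) (j - 1) : ℚ) : ℂ) -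
      ((Ideal.absNorm v.asIdeal : ℕ) : ℂ)⁻¹ * ((Flicker1998.phiHtwo (Ideal.absNorm v.asIdeal) j - Flicker1998.phiHtwo (Ideal.absNorm v.asIdeal) (j - 1) : ℚ) : ℂ) := by
    rw [e1]; push_cast; ring
  have E2 : ((Flicker1998.phiHtwo (Ideal.absNorm v.asIdeal) (j - 1) - Flicker1998.phiHtwo (Ideal.absNorm v.asIdeal) (j - 1 - 1) : ℚ) : ℂ) =
      ((Ideal.absNorm v.asIdeal : ℕ) : ℂ)⁻¹ * ((Flicker1998.phiHtwo (Ideal.absNorm v.asIdeal) j - Flicker1998.phiHtwo (Ideal.absNorm v.asIdeal) (j - 1) : ℚ) : ℂ) := by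
    rw [e2]; push_cast; ring
  -- the four stable values (★ Chi-aff heads at the two centres, depths `j − 1` and `j`)
  have h0u := stableOrbitalIntegralRel_chiZero_eq_mul_phiHtwo_of_not_exists_isRoot_affine L v w hw νH hunr hmH hreg' hirr' haO' hf' hj' htf' hde' hj1' htr' hdet' χdec₀
  have h1u := stableOrbitalIntegralRel_chiOne_eq_mul_phiHtwo_sub_of_not_exists_isRoot_affine L v w hw νH hunr hmH hreg' hirr' haO' hf' hj' htf' hde' hj1' htr' hdet' χdec₀ χdec₁
  have h0g := stableOrbitalIntegralRel_chiZero_eq_mul_phiHtwo_of_not_exists_isRoot_affine L v w hw νH hunr hmH hreg hirr haO hf hj htf hde hj1 htr hdet χdec₀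
  have h1g := stableOrbitalIntegralRel_chiOne_eq_mul_phiHtwo_sub_of_not_exists_isRoot_affine L v w hw νH hunr hmH hreg hirr haO hf hj htf hde hj1 htr hdet χdec₀ χdec₁
  constructor
  · linear_combination h0u - h0g + ((Ideal.absNorm v.asIdeal : ℕ) : ℂ)⁻¹ * h1g + (νH.real ((((cmLocalIntegralLevel L 2 (Matrix.of fun i j : Fin 2 => if i.val + j.val + 1 = 2 then (1 : L) else 0) v).prod (cmLocalIntegralLevel L 1 (Matrix.of fun i j : Fin 1 => if i.val + j.val + 1 = 1 then (1 : L) else 0) v)) : Subgroup ((cmDatum L 2 (Matrix.of fun i j : Fin 2 => if i.val + j.val + 1 = 2 then (1 : L) else 0)).Local v × (cmDatum L 1 (Matrix.of fun i j : Fin 1 => if i.val + j.val + 1 = 1 then (1 : L) else 0)).Local v)) : Set ((cmDatum L 2 (Matrix.of fun i j : Fin 2 => if i.val + j.val + 1 = 2 then (1 : L) else 0)).Local v × (cmDatum L 1 (Matrix.of fun i j : Fin 1 => if i.val + j.val + 1 = 1 then (1 : L) else 0)).Local v)) : ℂ) * E1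
  · linear_combination h1u - ((Ideal.absNorm v.asIdeal : ℕ) : ℂ)⁻¹ * h1g + (νH.real ((((cmLocalIntegralLevel L 2 (Matrix.of fun i j : Fin 2 => if i.val + j.val + 1 = 2 then (1 : L) else 0) v).prod (cmLocalIntegralLevel L 1 (Matrix.of fun i j : Fin 1 => if i.val + j.val + 1 = 1 then (1 : L) else 0) v)) : Subgroup ((cmDatum L 2 (Matrix.of fun i j : Fin 2 => if i.val + j.val + 1 = 2 then (1 : L) else 0)).Local v × (cmDatum L 1 (Matrix.of fun i j : Fin 1 => if i.val + j.val + 1 = 1 then (1 : L) else 0)).Local v)) : Set ((cmDatum L 2 (Matrix.of fun i j : Fin 2 => if i.val + j.val + 1 = 2 then (1 : L) else 0)).Local v × (cmDatum L 1 (Matrix.of fun i j : Fin 1 => if i.val + j.val + 1 = 1 then (1 : L) else 0)).Local v)) : ℂ) * E2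

end Place

end Literature.NumberTheory.Automorphic.UnitaryGroup

end
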